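import Literature.NumberTheory.EllipticCurves.ModularCurve
import Literature.NumberTheory.EllipticCurves.QuadraticTwist
import Literature.NumberTheory.EllipticCurves.Isogeny
import Literature.NumberTheory.EllipticCurves.GlobalMinimalModel
import Literature.NumberTheory.DiophantineGeometry.Conductor
import HarnessLib
import HarnessLib.Audit.Tags

/-!
# Candidate E-imc-7R: the UNCONDITIONAL exact degree trichotomy under a ramified twist, REPAIRED form
# (`RamifiedTwistDegreeTrichotomy p d`)
# — cell `bsd-f2-manin` (D-0131 (3) frontier: the Manin constant at additive primes). `@[conjecture]`
# leaf (NOTHING asserted; definition only; proved edge to E-imc-4 (i) in `RamifiedTwistExactEdges.lean`).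

HONEST FRAMING. LENS = Iwasawa-main-conjecture / Λ-adic integrality read as RAMIFIED-QUADRATIC-TWIST
laws at the additive prime (planner-of-record `bsd-f2-manin-imc`, HOME
`run/shared/lean/pub/bsd-f2-manin/MEMO-imc.md` §9 (g1); binder grammar VERBATIM from
HOME/imc/Sketch-imc-g1.lean (sha16 eda08fcdae877d26) with `pStar` / `IsLatticeOptimal` / `IsTwistDiscAt`
inlined exactly as in the landed g0 leaf `RamifiedTwistDegreeDichotomy`). «Ramified twist pair at `p`»:
`W`, `W′` globally minimal models of the `X₀(N)`-optimal curves of `𝒜` and `𝒜 ⊗ χ_d` (data at the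
CONDUCTOR levels with the lattice clauses), `p² ∣ N`, SAME conductor, `W′ ~ W ⊗ χ_d`; here CM and
rational `p`-isogenies ARE allowed (no irreducibility, no distinctness).

THIS ROW IS THE REPAIR C′ OF g1's E-imc-7. The g1 statement had a third disjunct «`deg′ = deg` and
`|v_pΔ′_min − v_pΔ_min| ≤ 2`»; refuter-1 KILLED it (refuted-misstated, HOME/REFUTER-ref1.md §R2.2):
witness N = 390150 = 2·3³·5²·17², (p, d) = (3, −3): optimal 390150gy1 (Kodaira IV, v₃Δ_min = 5,
deg φ₀ = 5 643 509 760, optimality PROVED) vs optimal 390150dc1 (IV*, v₃Δ_min = 9, the SAME degree,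
optimality PROVED), gy1 ⊗ χ₋₃ = dc2 which is 3-isogenous to dc1 — degrees equal but discriminant jump 4 > 2.
Minimal repair C′ (refuter-1, adopted by the planner-of-record, CANDIDATES row E-imc-7R): DELETE the jump
window of disjunct 3, keep its degree clause. EITHER `deg′ = p·deg` and `v_pΔ′_min = v_pΔ_min + 6`, OR the
mirror image, OR `deg′ = deg`. BC5 WITNESS: refuter-1's independent engine (HOME/ref1/R2-twistcensus-N5e5,
all N < 5·10⁵): C′ has 0 clean violations on 1 092 620 directed rows (the 4 alldegphi-erratum rows of §R2.1
aside); census v0 (N < 10⁵): ratio `p^{±1}` on 2 × 83 958 rows, all with jump ±6; ratio 1 on 410 362 rows.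
Refuter verdicts: REF1 = KILLED-as-g1 / **C′ SURVIVES** 2026-08-27T15:40Z (§R2.2; the proved edge
trichotomy ⟹ dichotomy survives C′ verbatim); REF2 (HOME/REFUTER-ref2.md §R2.18): SPLIT — (a) the modulus
trichotomy + flip clause is IN-PRINT-IMPLICIT (Edixhoven 1991 [texel L598–640]: Zagier 1985 inclusions +
Rankin–Selberg; Atkin–Lehner 1970 normaliser; a theorem target), (b) the coupling «`deg′ = p·deg` ⇒
`Δ′ = Δ + 6`» is the open case-1 exclusion of E-imc-6 / 1b / 2 (also for CM / reducible commuting pairs).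
-/

noncomputable section

open scoped MatrixGroups ModularForm

open CongruenceSubgroup WeierstrassCurve
  Literature.NumberTheory.EllipticCurves Literature.NumberTheory.EllipticCurves.ModularForms

namespace Summit.BirchSwinnertonDyer.Rank1Residual.ManinAdditive

/-- **Candidate E-imc-7R `RamifiedTwistDegreeTrichotomy p d` (cell bsd-f2-manin; a LAW, part (b) NOT in
print, nothing asserted; repaired form C′ of g1's E-imc-7):** for a prime `p`, an admissible twisting
discriminant `d` (`p*` for odd `p`; `−1, ±2` at `p = 2`) and a ramified twist pair of `X₀(N)`-optimal
curves `(W, D)`, `(W′, D′)` (globally minimal, data at the conductor levels with the lattice clauses) at the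
same conductor with `p² ∣ N` and `W′ ~ W ⊗ χ_d` (CM and rational `p`-isogenies allowed): EITHER
`deg φ_{D′} = p · deg φ_D` and `v_p Δ_min(W′) = v_p Δ_min(W) + 6`, OR `deg φ_D = p · deg φ_{D′}` and
`v_p Δ_min(W) = v_p Δ_min(W′) + 6`, OR `deg φ_{D′} = deg φ_D`.
[cite: Watkins2002, §2.1 p. 491 (shape only: the degree identity under twists; the trichotomy with its
discriminant coupling for OPTIMAL degrees is NOT in print — cell bsd-f2-manin MEMO-imc.md §9, E-imc-7;
repaired per HOME/REFUTER-ref1.md §R2.2)] -/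
@[conjecture] def RamifiedTwistDegreeTrichotomy (p : ℕ) (d : ℤ) : Prop :=
  ∀ (W W' : WeierstrassCurve ℚ) [W.IsElliptic] [W.IsGloballyMinimal] [W'.IsElliptic]
    [W'.IsGloballyMinimal] [NeZero (W.conductorNorm ℤ)] [NeZero (W'.conductorNorm ℤ)]
    (D : ModularParametrizationData W (W.conductorNorm ℤ))
    (D' : ModularParametrizationData W' (W'.conductorNorm ℤ)),
    p.Prime → ((d : ℚ) = ((((-1 : ℤ) ^ (p / 2) * p : ℤ) : ℚ)) ∨ (p = 2 ∧ (d = -1 ∨ d = 2 ∨ d = -2))) →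
    (∀ z ∈ D.L.lattice, ∃ w ∈ periodLattice D.f, z = D.c * w) →
    (∀ z ∈ D'.L.lattice, ∃ w ∈ periodLattice D'.f, z = D'.c * w) →
    p ^ 2 ∣ W.conductorNorm ℤ → W'.conductorNorm ℤ = W.conductorNorm ℤ →
    IsIsogenous (W.quadraticTwist (d : ℚ)) W' →
    (D'.modularDegree = p * D.modularDegree ∧
        padicValInt p W'.minimalDiscriminantInt = padicValInt p W.minimalDiscriminantInt + 6) ∨
    (D.modularDegree = p * D'.modularDegree ∧
        padicValInt p W.minimalDiscriminantInt = padicValInt p W'.minimalDiscriminantInt + 6) ∨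
    D'.modularDegree = D.modularDegree

end Summit.BirchSwinnertonDyer.Rank1Residual.ManinAdditive

end
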